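import Summits.ValiantsHypothesis.ValiantsHypothesis.Theorems.BarrierLeverPriorityPeelingSymmetries

/-!
# Route BarrierLever — priority peeling for TT: hyperoctahedral symmetry of TT layouts

Helper file (`--supports stmt-ValiantsHypothesis-19761`; cell valiant-natproofs, rung V4, 𝒟-side door
(c); prover val-np-p1 g7). Closes NO item. The symmetries of derivations (`PPDerivable.transport`,
p475414) specialised to TT layouts `u w : Fin r → Finset (Fin h)` (rows `a ↦ castAdd h a / natAdd h a`
by `a ∈ u i`, columns `c ↦ natAdd h c / castAdd h c` by `c ∈ w j`):

* `ppDerivable_layout_symm` — for EVERY `h`: if `b ∈ u i ↔ (π b ∈ u₀ (σ i)) xor (π b ∈ t)` (the rows of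
  `u` are those of `u₀` moved by a coordinate permutation `π`, flipped on `t`, re-indexed by `σ`) and
  likewise for the columns (`π', t', τ`, independently), then a derivation for `(u₀, w₀)` gives one for
  `(u, w)`. The literal relabeling is `castAdd a / natAdd a ↦` side swapped iff `a ∈ t`, coordinate
  `π⁻¹ a` (through `finSumFinEquiv`), the slot permutation is `π`.
* `exists_strictMono_enum` — an injective `c : Fin r → Fin n` has the same values as a strictly
  increasing `e : Fin r → Fin n` (`Finset.orderEmbOfFin` of its image);
* `eq_table_code3` — every subset of `Fin 3` is the entry of its code in the table
  `![∅, {0}, {1}, {0, 1}, {2}, {0, 2}, {1, 2}, {0, 1, 2}]`.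

These reduce the `h = 3` rung of item 19761 to `B₃ × B₃`-orbit representatives (sibling files
`…PriorityPeelingLayoutsThreeCanon`, `…LayoutsThreeCerts{A,B,C,D}`, `…LayoutsUpToThree`).

WHAT THIS IS NOT: bookkeeping; nothing on 19761 / TT (19152) in general, on crux
stmt-ValiantsHypothesis-14610, or on VP versus VNP.
-/

-- layout Summits/ValiantsHypothesis/ValiantsHypothesis forces the duplicated namespace component
set_option linter.dupNamespace false

namespace Summit.ValiantsHypothesis.ValiantsHypothesis.Theorems.BarrierLever.PPSmall

open Summit.ValiantsHypothesis.ValiantsHypothesis.Theorems.BarrierLever.PriorityPeeling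

/-! ## 1. The literal relabeling of a coordinate symmetry -/

/-- The relabeling on `Fin h ⊕ Fin h` (left summand = literals `castAdd`, right = `natAdd`): swap the
side iff the coordinate lies in `t`, and pull the coordinate back along `π`. It has a left inverse,
hence is injective. -/
theorem sumRelabel_injective (h : ℕ) (t : Finset (Fin h)) (π : Equiv.Perm (Fin h)) :
    Function.Injective (fun x : Fin h ⊕ Fin h => Sum.elim
      (fun a => if a ∈ t then Sum.inr (π.symm a) else Sum.inl (π.symm a))
      (fun a => if a ∈ t then Sum.inl (π.symm a) else Sum.inr (π.symm a)) x) := by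
  refine Function.LeftInverse.injective (g := fun y : Fin h ⊕ Fin h => Sum.elim
      (fun b => if π b ∈ t then Sum.inr (π b) else Sum.inl (π b))
      (fun b => if π b ∈ t then Sum.inl (π b) else Sum.inr (π b)) y) ?_
  intro x
  rcases x with a | a <;> by_cases ha : a ∈ t <;> simp [ha]

/-! ## 2. Hyperoctahedral symmetry of TT layouts -/

/-- **Coordinate symmetries transport derivations of TT layouts** (every `h`). If the rows of `u`
arise from those of `u₀` by a coordinate permutation `π`, a flip on `t` and a re-indexing `σ` — in
membership form `b ∈ u i ↔ (π b ∈ u₀ (σ i)) xor (π b ∈ t)` — and the columns of `w` from those of `w₀`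
likewise (`π', t', τ`), then a priority-peeling derivation for `(u₀, w₀)` yields one for `(u, w)`. -/
theorem ppDerivable_layout_symm (h r : ℕ) (u w u₀ w₀ : Fin r → Finset (Fin h))
    (π π' : Equiv.Perm (Fin h)) (t t' : Finset (Fin h)) (σ τ : Equiv.Perm (Fin r))
    (hu : ∀ i b, b ∈ u i ↔ Xor (π b ∈ u₀ (σ i)) (π b ∈ t))
    (hw : ∀ j b, b ∈ w j ↔ Xor (π' b ∈ w₀ (τ j)) (π' b ∈ t'))
    (h₀ : PPDerivable (h + h) (h + h) (Fin r) h
      (fun i a => if a ∈ u₀ i then Fin.castAdd h a else Fin.natAdd h a)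
      (fun j c => if c ∈ w₀ j then Fin.natAdd h c else Fin.castAdd h c)) :
    PPDerivable (h + h) (h + h) (Fin r) h
      (fun i a => if a ∈ u i then Fin.castAdd h a else Fin.natAdd h a)
      (fun j c => if c ∈ w j then Fin.natAdd h c else Fin.castAdd h c) := by
  refine h₀.transport
    (fun x : Fin (h + h) => finSumFinEquiv (Sum.elim
      (fun a => if a ∈ t then Sum.inr (π.symm a) else Sum.inl (π.symm a))
      (fun a => if a ∈ t then Sum.inl (π.symm a) else Sum.inr (π.symm a)) (finSumFinEquiv.symm x)))
    (fun x : Fin (h + h) => finSumFinEquiv (Sum.elim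
      (fun a => if a ∈ t' then Sum.inr (π'.symm a) else Sum.inl (π'.symm a))
      (fun a => if a ∈ t' then Sum.inl (π'.symm a) else Sum.inr (π'.symm a)) (finSumFinEquiv.symm x)))
    (finSumFinEquiv.injective.comp ((sumRelabel_injective h t π).comp finSumFinEquiv.symm.injective))
    (finSumFinEquiv.injective.comp
      ((sumRelabel_injective h t' π').comp finSumFinEquiv.symm.injective))
    π π' σ τ _ _ (fun i => ?_) (fun j => ?_)
  · funext b
    simp only [Function.comp_apply]
    have hb := hu i b
    by_cases h1 : π b ∈ u₀ (σ i) <;> by_cases h2 : π b ∈ t <;>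
      simp only [Xor, h1, h2, not_true, not_false_iff, and_true, and_false, or_false, false_or,
        iff_true, iff_false] at hb <;>
      simp only [hb, h1, h2, if_true, if_false, finSumFinEquiv_symm_apply_castAdd,
        finSumFinEquiv_symm_apply_natAdd, Sum.elim_inl, Sum.elim_inr, finSumFinEquiv_apply_left,
        finSumFinEquiv_apply_right, Equiv.symm_apply_apply]
  · funext b
    simp only [Function.comp_apply]
    have hb := hw j b
    by_cases h1 : π' b ∈ w₀ (τ j) <;> by_cases h2 : π' b ∈ t' <;>
      simp only [Xor, h1, h2, not_true, not_false_iff, and_true, and_false, or_false, false_or,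
        iff_true, iff_false] at hb <;>
      simp only [hb, h1, h2, if_true, if_false, finSumFinEquiv_symm_apply_castAdd,
        finSumFinEquiv_symm_apply_natAdd, Sum.elim_inl, Sum.elim_inr, finSumFinEquiv_apply_left,
        finSumFinEquiv_apply_right, Equiv.symm_apply_apply]

/-! ## 3. Small tools for the `h = 3` reduction -/

/-- An injective map into `Fin n` takes the same values as a strictly increasing one (the order
embedding of its image). -/
theorem exists_strictMono_enum {r n : ℕ} (c : Fin r → Fin n) (hc : Function.Injective c) :
    ∃ e : Fin r → Fin n, StrictMono e ∧ (∀ i, ∃ j, c i = e j) ∧ (∀ j, ∃ i, e j = c i) := by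
  classical
  have hA : (Finset.univ.image c).card = r := by
    rw [Finset.card_image_of_injective _ hc, Finset.card_univ, Fintype.card_fin]
  refine ⟨fun j => (Finset.univ.image c).orderEmbOfFin hA j, ((Finset.univ.image c).orderEmbOfFin hA).strictMono,
    fun i => ?_, fun j => ?_⟩
  · have hi : c i ∈ Set.range ((Finset.univ.image c).orderEmbOfFin hA) := by
      rw [Finset.range_orderEmbOfFin]
      simp
    obtain ⟨j, hj⟩ := hi
    exact ⟨j, hj.symm⟩
  · have hj : (Finset.univ.image c).orderEmbOfFin hA j ∈ Finset.univ.image c :=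
      Finset.orderEmbOfFin_mem _ _ j
    obtain ⟨i, -, hi⟩ := Finset.mem_image.mp hj
    exact ⟨i, hi.symm⟩

/-- Every subset of `Fin 3` is the table entry of its code. -/
theorem eq_table_code3 (s : Finset (Fin 3)) :
    s = (![∅, {0}, {1}, {0, 1}, {2}, {0, 2}, {1, 2}, {0, 1, 2}] : Fin 8 → Finset (Fin 3))
      (if (0 : Fin 3) ∈ s then
        (if (1 : Fin 3) ∈ s then (if (2 : Fin 3) ∈ s then 7 else 3)
          else (if (2 : Fin 3) ∈ s then 5 else 1))
      else
        (if (1 : Fin 3) ∈ s then (if (2 : Fin 3) ∈ s then 6 else 2)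
          else (if (2 : Fin 3) ∈ s then 4 else 0))) := by
  by_cases h0 : (0 : Fin 3) ∈ s <;> by_cases h1 : (1 : Fin 3) ∈ s <;> by_cases h2 : (2 : Fin 3) ∈ s <;>
    simp only [h0, h1, h2, if_true, if_false] <;> ext a <;> fin_cases a <;> simp [h0, h1, h2]

end Summit.ValiantsHypothesis.ValiantsHypothesis.Theorems.BarrierLever.PPSmall
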